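/-
Copyright (c) 2026 the pub-hodgecm-mathlib formalisation cell (harness21).  Prover seat hodgecm-mathlib-F0P2-p10 (g4), Track B ∕ R90-TF, h413 = `stmt-HodgeConjecture-24833`,
R90-TF section S8 «ContSpec-n½», socket (E) `sock_S8_res_exhaustion_le_closure` (B ED. 7 :276): the (L1) PROJECTOR∕TRUNCATION BOOKKEEPING of the E1 Plancherel estate's bill for the
τ-cut projector — the `hT𝓐` and `hTP` rows of ★ (N_blk,₃) ∕ its χ_τ-edition `…_of_conv` for Hecke operators `T_j = R_∞(a_j) ∘L R_f(b_j)` with `a_j` conjugation-invariant under `K_∞`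
(S8 dealer R90-CS-plan (g3) S8-R248 (4); census `K2/K2E1-p14/g4/CENSUS-E4-PlancherelEstate.K2E1-p14-g4.md` row (4)).
-/
import Summits.HodgeConjecture.HodgeConjecture.Theorems.K2E1KTypeProjectorPureTensorU      -- ★ (K2E2-p12): `kType_comm_restrict`, `kType_comm_integratedOperator`, `hh_of_spherical` (1-dim); brings ★ p860333 `commute_pureTensor_of_separate`, `comp_integratedOperator_comm_of_forall`, `cm_hcomm`, ★ `IntegratedOperatorStar` ∕ `…FixedVectors`
import HarnessLib

/-!
# S8 (E) road — `R90S8ResGBlockHeckeCommuteTauU3`: the (L1) rows `hT𝓐`, `hTP` of the E1 block estate for the τ-cut projector `e_τ ∘L R_f(e)` and pure-tensor Hecke operators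
# `T_j = R_∞(a_j) ∘L R_f(b_j)` with `a_j` CONJUGATION-INVARIANT under `K_∞` (every `N`, every hermitian `H`, every unitary `π`)

Track B ∕ R90-TF, crux h413 = `stmt-HodgeConjecture-24833`, route of record `HCCMUnconditional`; cell `hodgecm-mathlib`, R90-TF programme, section S8 «ContSpec-n½», socket (E)
(B ED. 7 :276) through ★ `res_exhaustion_le_closure_of_record`, (N₃) row paid PER `K_∞`-TYPE `τ` (K-TYPE CURRENCY FLAG S8-R189) by the τ-edition of D5′ (★ `resG_isotypic_le_orthogonal_lines_of_conv`,
K2E1-p16 (g4)), whose bill carries the (L1) letters `T hT𝓐 hTP hTB` for the block projector `P = π_K(χK) ∘L R_f(e)` (`χK := χ_τ♮ = dim τ • conj χ_τ`, NOT multiplicative for `dim τ > 1`).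
The 1-dimensional road pays `hTP` through ★ `hh_of_spherical` (uses `hχmul`); THIS FILE pays `hT𝓐` and `hTP` for ANY kernel `χK ∈ C_c(K, ℂ)` when the archimedean test functions `a_j` are
CONJUGATION-INVARIANT under `κ(K)` (`a_j (κ k · x · (κ k)⁻¹) = a_j x`) and the finite ones commute with the level kernel (`R_f(e) R_f(b_j) = R_f(b_j) R_f(e)`, e.g. `e ⋆ b_j = b_j ⋆ e`).
THEOREMS ONLY (no `def`, no `instance`, no `notation`, no named-fact hypothesis, no `sorry`; default heartbeats); lane `--supports stmt-HodgeConjecture-24833 --as helper` (count-neutral).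
CLOSES NO SOCKET.

THE MATHEMATICS ([Knapp1986, VIII §3]; [DeitmarEchterhoff2014, Lemma 1.6.3, Prop. 6.2.1]; [Gelbart1975, (10.12)–(10.13)]; [BorelJacquet1979, §4.1]).  For `h ∈ C_c(G₁)` invariant under
conjugation by `g₀`, the left and right translates agree, `h(g₀⁻¹ x) = h(x g₀⁻¹)`, so `π(ι₁ g₀) ∘ R₁(h) = R₁(λ_{g₀} h) = R₁(ρ_{g₀} h) = R₁(h) ∘ π(ι₁ g₀)` (★ `apply_comp_integratedOperator`, ★
`integratedOperator_comp_apply_eq`; `η₁` two-sided invariant).  Hence `R₁(h)` commutes with every `π(ι₁ κ k)` and so with `π_K(χ) = ∫_K χ(k) π(ι₁ κ k) dμ_K` for ANY `χ` (★ `comp_integratedOperator_comm_of_forall`)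
— the `hh` letter of ★ p860333 `commute_pureTensor_of_separate`, which then gives `Commute (π_K(χ) ∘L R₂ e) (R₁ h ∘L R₂ b)` from `hP` (★ `kType_comm_restrict`) and `R₂ e R₂ b = R₂ b R₂ e`; the latter
follows from a symmetric convolution identity `e ⋆ b = b ⋆ e` (★ `integratedOperator_comp_integratedOperator`).
* §1 GENERIC (frame of ★ `K2E1KTypeProjectorPureTensorU`: `π` of `G`, `ι₁ : G₁ →* G`, `ι₂ : G₂ →* G`, `κ : K →* G₁`, kernel `χ ∈ C_c(K)`, Haar-type `μK, η₁, η₂`):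
  `restrict_apply_comm_integratedOperator_of_conjInvariant`; **`integratedOperator_comm_kType_of_conjInvariant`** (the `hh` letter for ANY `χ`); **`commute_kTypeLevel_pureTensor_of_conjInvariant`**
  (`Commute (π_K(χ) ∘L R₂ e) (R₁ h ∘L R₂ b)`); `integratedOperator_comm_of_mulConv_comm` (`R₂ e R₂ b = R₂ b R₂ e` from `e ⋆ b = b ⋆ e`); `pureTensor_mem` (`hT𝓐` by construction).
* §2 AT ★ `cmDatum L N H` (every `N`, every `H`, every unitary strongly continuous `π` — E1: `R` on `L²(U(J₃))`), in ★ D5′-cm's ∕ (N_blk,₃)'s binder spelling: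
  **`cm_hT𝓐_of_pureTensor`** and **`cm_hTP_of_conjInvariant`** — the `hT𝓐 hTP` rows for `T j := R_∞(a j) ∘L R_f(b j)`, `P := π_K(χK) ∘L R_f(e)`, from `hAd` + `heb`.
WHAT (L1) STILL OWES at `N = 3` (honest, census-E4 row (4)): the CHOICE of `(a_j, b_j)` with symbols `hU` on `V_P`, the commutativity row `hTB` (τ-spherical Hecke algebra) and (L3) `hline` — L∕XL,
not claimed here; the visible letters of this file are `hAd` (conjugation invariance of `a_j` under `κ(K)`) and `heb` (or `e ⋆ b_j = b_j ⋆ e`).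
HONEST LABEL: HC_CM is proved only modulo the 7 printed citations (2 remaining named inputs: hLiu418 = `stmt-HodgeConjecture-24832`, h413 = `stmt-HodgeConjecture-24833`) until
rung 0 closes; REL ≠ ★ ≠ BUILT; this file asserts no named fact and closes no socket; count-neutral; unconditional (structural binders visible).

## References
* [Knapp1986] A. W. Knapp, *Representation Theory of Semisimple Groups* (1986), VIII §3.
* [DeitmarEchterhoff2014] A. Deitmar, S. Echterhoff, *Principles of Harmonic Analysis* (2nd ed., 2014), Lemma 1.6.3, Prop. 6.2.1.
* [Gelbart1975] S. Gelbart, *Automorphic Forms on Adele Groups* (1975), (10.12)–(10.13).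
* [BorelJacquet1979] A. Borel, H. Jacquet, *Automorphic forms and automorphic representations*, PSPM 33.1 (1979), §4.1.
-/

set_option autoImplicit false
set_option linter.dupNamespace false  -- the mandated namespace `…HodgeConjecture.HodgeConjecture.R90.S8` (LEAD #1 L1) repeats the summit's segment

noncomputable section

open MeasureTheory Filter Topology CompactlySupported NumberField ContRepresentation Set
open scoped InnerProductSpace ENNReal ComplexConjugate
open Literature.NumberTheory.Automorphic Literature.NumberTheory.Automorphic.UnitaryGroup Literature.NumberTheory.GaloisRepresentations AdelicGroupData
open Summit.HodgeConjecture.HodgeConjecture.Cruxes.H413.K2E1PureTensorHeckeAlgebraU (restrict_comp_integratedOperator_comm comp_integratedOperator_comm_of_forall commute_pureTensor_of_separate cm_hcomm)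
open Summit.HodgeConjecture.HodgeConjecture.Cruxes.H413.K2E1KTypeProjectorPureTensorU (kType_comm_restrict kType_comm_integratedOperator)

namespace Summit.HodgeConjecture.HodgeConjecture.R90.S8

/-! ## §1 Generic: conjugation-invariant test functions commute with every `K`-kernel operator -/

section Generic

variable {G G₁ G₂ K V : Type*} [Group G] [TopologicalSpace G]
  [Group G₁] [TopologicalSpace G₁] [IsTopologicalGroup G₁] [MeasurableSpace G₁] [BorelSpace G₁]
  [Group G₂] [TopologicalSpace G₂] [IsTopologicalGroup G₂] [MeasurableSpace G₂] [BorelSpace G₂]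
  [Group K] [TopologicalSpace K] [MeasurableSpace K] [BorelSpace K]
  [NormedAddCommGroup V] [InnerProductSpace ℂ V] [CompleteSpace V]
  (π : ContRepresentation ℂ G V) (hu : π.IsUnitary) (hc : π.IsStronglyContinuous)
  (ι₁ : G₁ →* G) (hι₁ : Continuous ι₁) (ι₂ : G₂ →* G) (hι₂ : Continuous ι₂) (κ : K →* G₁) (hκ : Continuous κ)
  (μK : Measure K) [IsFiniteMeasureOnCompacts μK] (χ : C_c(K, ℂ))
  (η₁ : Measure G₁) (η₂ : Measure G₂) [IsFiniteMeasureOnCompacts η₁] [IsFiniteMeasureOnCompacts η₂]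

omit [IsTopologicalGroup G₂] [MeasurableSpace G₂] [BorelSpace G₂] [MeasurableSpace K] [BorelSpace K] in
/-- **`π(ι₁ g₀)` COMMUTES WITH `R₁(h)` FOR `h` INVARIANT UNDER CONJUGATION BY `g₀`**: `h(g₀ x g₀⁻¹) = h(x)` makes the left translate `x ↦ h(g₀⁻¹ x)` and the right translate `x ↦ h(x g₀⁻¹)`
the SAME function, so `π(ι₁ g₀) ∘ R₁(h) = R₁(λ_{g₀} h) = R₁(ρ_{g₀} h) = R₁(h) ∘ π(ι₁ g₀)` (★ `apply_comp_integratedOperator`, ★ `integratedOperator_comp_apply_eq`; `η₁` two-sided invariant).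
[cite: DeitmarEchterhoff2014, Lemma 1.6.3] [cite: Knapp1986, VIII §3] -/
theorem restrict_apply_comm_integratedOperator_of_conjInvariant [MeasurableMul G₁] [η₁.IsMulLeftInvariant] [η₁.IsMulRightInvariant]
    (g₀ : G₁) (h : C_c(G₁, ℂ)) (hAd : ∀ x, h (g₀ * x * g₀⁻¹) = h x) :
    π (ι₁ g₀) ∘L (π.restrict ι₁).integratedOperator (hu.restrict ι₁) (hc.restrict ι₁ hι₁) η₁ h = (π.restrict ι₁).integratedOperator (hu.restrict ι₁) (hc.restrict ι₁ hι₁) η₁ h ∘L π (ι₁ g₀) := by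
  obtain ⟨h', hh'⟩ := exists_compactlySupported_leftTranslate g₀ h
  have e1 := ContRepresentation.apply_comp_integratedOperator (hu.restrict ι₁) (hc.restrict ι₁ hι₁) η₁ g₀ h h' hh'
  have e2 := ContRepresentation.integratedOperator_comp_apply_eq (hu.restrict ι₁) (hc.restrict ι₁ hι₁) η₁ g₀ h h' fun x => by
    rw [hh', ← hAd (g₀⁻¹ * x), mul_inv_cancel_left]
  rw [ContRepresentation.restrict_apply] at e1 e2
  rw [e1, e2]

omit [IsTopologicalGroup G₂] [MeasurableSpace G₂] [BorelSpace G₂] in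
/-- **THE `hh` LETTER FOR ANY KERNEL: `R₁(h) ∘ π_K(χ) = π_K(χ) ∘ R₁(h)`** when `h` is invariant under conjugation by `κ(K)` — `R₁(h)` commutes with every `π(ι₁ κ k)` (previous lemma), hence with
`π_K(χ) = ∫_K χ(k) π(ι₁ κ k) dμ_K` (★ `comp_integratedOperator_comm_of_forall`).  No multiplicativity of `χ` is used: serves `χ := χ_τ♮ = dim τ • conj χ_τ` (K2E1-p16's τ-edition) as well as
characters. [cite: Knapp1986, VIII §3] [cite: DeitmarEchterhoff2014, Prop. 6.2.1] -/
theorem integratedOperator_comm_kType_of_conjInvariant [MeasurableMul G₁] [η₁.IsMulLeftInvariant] [η₁.IsMulRightInvariant]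
    (h : C_c(G₁, ℂ)) (hAd : ∀ (k : K) (x : G₁), h (κ k * x * (κ k)⁻¹) = h x) :
    (π.restrict ι₁).integratedOperator (hu.restrict ι₁) (hc.restrict ι₁ hι₁) η₁ h ∘L (π.restrict (ι₁.comp κ)).integratedOperator (hu.restrict (ι₁.comp κ)) (hc.restrict (ι₁.comp κ) (hι₁.comp hκ)) μK χ =
      (π.restrict (ι₁.comp κ)).integratedOperator (hu.restrict (ι₁.comp κ)) (hc.restrict (ι₁.comp κ) (hι₁.comp hκ)) μK χ ∘L (π.restrict ι₁).integratedOperator (hu.restrict ι₁) (hc.restrict ι₁ hι₁) η₁ h :=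
  comp_integratedOperator_comm_of_forall π hu hc (ι₁.comp κ) (hι₁.comp hκ) μK _
    (fun k => (restrict_apply_comm_integratedOperator_of_conjInvariant π hu hc ι₁ hι₁ η₁ (κ k) h (hAd k)).symm) χ

omit [IsTopologicalGroup G₂] in
/-- **`hTP` FOR A CONJUGATION-INVARIANT ARCHIMEDEAN TEST FUNCTION**: `Commute (π_K(χ) ∘L R₂ e) (R₁ h ∘L R₂ b)` — ★ p860333 `commute_pureTensor_of_separate` with `hP` := ★ `kType_comm_restrict`
(images of `ι₁`, `ι₂` commute), `hh` := `integratedOperator_comm_kType_of_conjInvariant`, and the finite commutation `heb : R₂ e R₂ b = R₂ b R₂ e`. [cite: Gelbart1975, (10.12)–(10.13)]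
[cite: Knapp1986, VIII §3] -/
theorem commute_kTypeLevel_pureTensor_of_conjInvariant [MeasurableMul G₁] [η₁.IsMulLeftInvariant] [η₁.IsMulRightInvariant]
    (hcomm : ∀ (x : G₁) (y : G₂), ι₁ x * ι₂ y = ι₂ y * ι₁ x) (h : C_c(G₁, ℂ)) (hAd : ∀ (k : K) (x : G₁), h (κ k * x * (κ k)⁻¹) = h x) (e b : C_c(G₂, ℂ))
    (heb : (π.restrict ι₂).integratedOperator (hu.restrict ι₂) (hc.restrict ι₂ hι₂) η₂ e ∘L (π.restrict ι₂).integratedOperator (hu.restrict ι₂) (hc.restrict ι₂ hι₂) η₂ b = (π.restrict ι₂).integratedOperator (hu.restrict ι₂) (hc.restrict ι₂ hι₂) η₂ b ∘L (π.restrict ι₂).integratedOperator (hu.restrict ι₂) (hc.restrict ι₂ hι₂) η₂ e) :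
    Commute ((π.restrict (ι₁.comp κ)).integratedOperator (hu.restrict (ι₁.comp κ)) (hc.restrict (ι₁.comp κ) (hι₁.comp hκ)) μK χ ∘L (π.restrict ι₂).integratedOperator (hu.restrict ι₂) (hc.restrict ι₂ hι₂) η₂ e)
      ((π.restrict ι₁).integratedOperator (hu.restrict ι₁) (hc.restrict ι₁ hι₁) η₁ h ∘L (π.restrict ι₂).integratedOperator (hu.restrict ι₂) (hc.restrict ι₂ hι₂) η₂ b) :=
  (commute_pureTensor_of_separate π hu hc ι₁ hι₁ ι₂ hι₂ η₁ η₂ hcomm _ (kType_comm_restrict π hu hc ι₁ hι₁ ι₂ κ hκ μK χ hcomm) h b e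
    (integratedOperator_comm_kType_of_conjInvariant π hu hc ι₁ hι₁ κ hκ μK χ η₁ h hAd) heb.symm).symm

omit [IsTopologicalGroup G₁] [MeasurableSpace G₁] [BorelSpace G₁] [MeasurableSpace K] [BorelSpace K] in
/-- **`R₂ e R₂ b = R₂ b R₂ e` FROM A SYMMETRIC CONVOLUTION IDENTITY**: if `F = e ⋆ b = b ⋆ e` pointwise (e.g. `e` the level idempotent of `K′` and `b` bi-`K′`-invariant: both convolutions equal
`b`), then the two operators commute (★ `integratedOperator_comp_integratedOperator`). [cite: DeitmarEchterhoff2014, Prop. 6.2.1, Lemma 1.6.3] -/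
theorem integratedOperator_comm_of_mulConv_comm [SecondCountableTopology G₂] [SFinite η₂] [η₂.IsMulLeftInvariant] (e b F : C_c(G₂, ℂ))
    (hF : ∀ x, F x = mulConv η₂ (⇑e) (⇑b) x) (hF' : ∀ x, F x = mulConv η₂ (⇑b) (⇑e) x) :
    (π.restrict ι₂).integratedOperator (hu.restrict ι₂) (hc.restrict ι₂ hι₂) η₂ e ∘L (π.restrict ι₂).integratedOperator (hu.restrict ι₂) (hc.restrict ι₂ hι₂) η₂ b = (π.restrict ι₂).integratedOperator (hu.restrict ι₂) (hc.restrict ι₂ hι₂) η₂ b ∘L (π.restrict ι₂).integratedOperator (hu.restrict ι₂) (hc.restrict ι₂ hι₂) η₂ e := by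
  rw [ContRepresentation.integratedOperator_comp_integratedOperator (hu.restrict ι₂) (hc.restrict ι₂ hι₂) η₂ e b F hF,
    ContRepresentation.integratedOperator_comp_integratedOperator (hu.restrict ι₂) (hc.restrict ι₂ hι₂) η₂ b e F hF']

omit [IsTopologicalGroup G₁] [IsTopologicalGroup G₂] [TopologicalSpace K] [MeasurableSpace K] [BorelSpace K] in
/-- **`hT𝓐` BY CONSTRUCTION**: `R₁(a) ∘L R₂(b)` is a pure tensor. [cite: Gelbart1975, (10.12)–(10.13)] -/
theorem pureTensor_mem (a : C_c(G₁, ℂ)) (b : C_c(G₂, ℂ)) :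
    (π.restrict ι₁).integratedOperator (hu.restrict ι₁) (hc.restrict ι₁ hι₁) η₁ a ∘L (π.restrict ι₂).integratedOperator (hu.restrict ι₂) (hc.restrict ι₂ hι₂) η₂ b ∈
      {A : V →L[ℂ] V | ∃ (a' : C_c(G₁, ℂ)) (b' : C_c(G₂, ℂ)), A = (π.restrict ι₁).integratedOperator (hu.restrict ι₁) (hc.restrict ι₁ hι₁) η₁ a' ∘L (π.restrict ι₂).integratedOperator (hu.restrict ι₂) (hc.restrict ι₂ hι₂) η₂ b'} :=
  ⟨a, b, rfl⟩

end Generic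

/-! ## §2 At ★ `cmDatum L N H`: the `hT𝓐`, `hTP` rows of ★ D5′-cm ∕ (N_blk) for `T_j = R_∞(a_j) ∘L R_f(b_j)`, `P = π_K(χK) ∘L R_f(e)` -/

section CM

variable {L : Type} [Field L] [NumberField L] [IsCMField L] {N : ℕ} {H : Matrix (Fin N) (Fin N) L}
  {K V : Type*} [Group K] [TopologicalSpace K] [MeasurableSpace K] [BorelSpace K]
  [NormedAddCommGroup V] [InnerProductSpace ℂ V] [CompleteSpace V]
  (π : ContRepresentation ℂ (cmDatum L N H).Adelic V) (hu : π.IsUnitary) (hc : π.IsStronglyContinuous)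
  [MeasurableSpace (UnitaryGroup.arch (↥(maximalRealSubfield L)) L (IsCMField.complexConj L) N H)] [BorelSpace (UnitaryGroup.arch (↥(maximalRealSubfield L)) L (IsCMField.complexConj L) N H)]
  [MeasurableSpace (finAdelic (↥(maximalRealSubfield L)) L (IsCMField.complexConj L) N H)] [BorelSpace (finAdelic (↥(maximalRealSubfield L)) L (IsCMField.complexConj L) N H)]
  (νinf : Measure (UnitaryGroup.arch (↥(maximalRealSubfield L)) L (IsCMField.complexConj L) N H)) [IsFiniteMeasureOnCompacts νinf]
  (νf : Measure (finAdelic (↥(maximalRealSubfield L)) L (IsCMField.complexConj L) N H)) [IsFiniteMeasureOnCompacts νf]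
  (κ : K →* UnitaryGroup.arch (↥(maximalRealSubfield L)) L (IsCMField.complexConj L) N H) (hκ : Continuous κ)
  (μK : Measure K) [IsFiniteMeasureOnCompacts μK] (χK : C_c(K, ℂ)) (e : C_c(finAdelic (↥(maximalRealSubfield L)) L (IsCMField.complexConj L) N H, ℂ))
  {J : Type*}

/-- **`hT𝓐` AT `cmDatum`**: the pure-tensor Hecke operators `T j := R_∞(a j) ∘L R_f(b j)` lie in the pure-tensor set of ★ D5′-cm's `hT𝓐` binder. [cite: Gelbart1975, (10.12)–(10.13)] -/
theorem cm_hT𝓐_of_pureTensor (a : J → C_c(UnitaryGroup.arch (↥(maximalRealSubfield L)) L (IsCMField.complexConj L) N H, ℂ)) (b : J → C_c(finAdelic (↥(maximalRealSubfield L)) L (IsCMField.complexConj L) N H, ℂ)) (T : J → V →L[ℂ] V)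
    (hT : ∀ j, T j = (π.restrict (archToAdelic (↥(maximalRealSubfield L)) L (IsCMField.complexConj L) N H)).integratedOperator (hu.restrict _) (hc.restrict _ (continuous_archToAdelic (↥(maximalRealSubfield L)) L (IsCMField.complexConj L) N H)) νinf (a j) ∘L
      (π.restrict (finAdelicToAdelic (↥(maximalRealSubfield L)) L (IsCMField.complexConj L) N H)).integratedOperator (hu.restrict _) (hc.restrict _ (continuous_finAdelicToAdelic (↥(maximalRealSubfield L)) L (IsCMField.complexConj L) N H)) νf (b j)) :
    ∀ j, T j ∈ {A : V →L[ℂ] V | ∃ (a : C_c(UnitaryGroup.arch (↥(maximalRealSubfield L)) L (IsCMField.complexConj L) N H, ℂ)) (b : C_c(finAdelic (↥(maximalRealSubfield L)) L (IsCMField.complexConj L) N H, ℂ)),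
      A = (π.restrict (archToAdelic (↥(maximalRealSubfield L)) L (IsCMField.complexConj L) N H)).integratedOperator (hu.restrict _) (hc.restrict _ (continuous_archToAdelic (↥(maximalRealSubfield L)) L (IsCMField.complexConj L) N H)) νinf a ∘L
          (π.restrict (finAdelicToAdelic (↥(maximalRealSubfield L)) L (IsCMField.complexConj L) N H)).integratedOperator (hu.restrict _) (hc.restrict _ (continuous_finAdelicToAdelic (↥(maximalRealSubfield L)) L (IsCMField.complexConj L) N H)) νf b} := fun j =>
  ⟨a j, b j, hT j⟩

/-- **`hTP` AT `cmDatum` FOR CONJUGATION-INVARIANT ARCHIMEDEAN TEST FUNCTIONS**: with `P := π_K(χK) ∘L R_f(e)` (★ D5′-cm's `hPdef` spelling; `χK` ANY kernel — characters or `χ_τ♮`) and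
`T j := R_∞(a j) ∘L R_f(b j)`, if every `a j` is invariant under conjugation by `κ(K)` (`hAd`) and every `R_f(b j)` commutes with `R_f(e)` (`heb`), then `∀ j, Commute P (T j)` — the `hTP`
binder of ★ D5′-cm `subrep_le_orthogonal_of_lineModel_cm` ∕ ★ (N_blk,₃) ∕ their `…_of_conv` editions (§1 at `ι₁ := ι_∞`, `ι₂ := ι_f`, `hcomm := ★ cm_hcomm`). [cite: Knapp1986, VIII §3]
[cite: Gelbart1975, (10.12)–(10.13)] [cite: BorelJacquet1979, §4.1] -/
theorem cm_hTP_of_conjInvariant [MeasurableMul (UnitaryGroup.arch (↥(maximalRealSubfield L)) L (IsCMField.complexConj L) N H)] [νinf.IsMulLeftInvariant] [νinf.IsMulRightInvariant] (a : J → C_c(UnitaryGroup.arch (↥(maximalRealSubfield L)) L (IsCMField.complexConj L) N H, ℂ)) (b : J → C_c(finAdelic (↥(maximalRealSubfield L)) L (IsCMField.complexConj L) N H, ℂ)) (T : J → V →L[ℂ] V)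
    (hT : ∀ j, T j = (π.restrict (archToAdelic (↥(maximalRealSubfield L)) L (IsCMField.complexConj L) N H)).integratedOperator (hu.restrict _) (hc.restrict _ (continuous_archToAdelic (↥(maximalRealSubfield L)) L (IsCMField.complexConj L) N H)) νinf (a j) ∘L
      (π.restrict (finAdelicToAdelic (↥(maximalRealSubfield L)) L (IsCMField.complexConj L) N H)).integratedOperator (hu.restrict _) (hc.restrict _ (continuous_finAdelicToAdelic (↥(maximalRealSubfield L)) L (IsCMField.complexConj L) N H)) νf (b j))
    (hAd : ∀ (j : J) (k : K) (x : UnitaryGroup.arch (↥(maximalRealSubfield L)) L (IsCMField.complexConj L) N H), a j (κ k * x * (κ k)⁻¹) = a j x)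
    (heb : ∀ j, (π.restrict (finAdelicToAdelic (↥(maximalRealSubfield L)) L (IsCMField.complexConj L) N H)).integratedOperator (hu.restrict _) (hc.restrict _ (continuous_finAdelicToAdelic (↥(maximalRealSubfield L)) L (IsCMField.complexConj L) N H)) νf e ∘L
        (π.restrict (finAdelicToAdelic (↥(maximalRealSubfield L)) L (IsCMField.complexConj L) N H)).integratedOperator (hu.restrict _) (hc.restrict _ (continuous_finAdelicToAdelic (↥(maximalRealSubfield L)) L (IsCMField.complexConj L) N H)) νf (b j) =
      (π.restrict (finAdelicToAdelic (↥(maximalRealSubfield L)) L (IsCMField.complexConj L) N H)).integratedOperator (hu.restrict _) (hc.restrict _ (continuous_finAdelicToAdelic (↥(maximalRealSubfield L)) L (IsCMField.complexConj L) N H)) νf (b j) ∘L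
        (π.restrict (finAdelicToAdelic (↥(maximalRealSubfield L)) L (IsCMField.complexConj L) N H)).integratedOperator (hu.restrict _) (hc.restrict _ (continuous_finAdelicToAdelic (↥(maximalRealSubfield L)) L (IsCMField.complexConj L) N H)) νf e)
    (P : V →L[ℂ] V) (hPdef : P = (π.restrict ((archToAdelic (↥(maximalRealSubfield L)) L (IsCMField.complexConj L) N H).comp κ)).integratedOperator (hu.restrict _)
          (hc.restrict _ ((continuous_archToAdelic (↥(maximalRealSubfield L)) L (IsCMField.complexConj L) N H).comp hκ)) μK χK ∘L
        (π.restrict (finAdelicToAdelic (↥(maximalRealSubfield L)) L (IsCMField.complexConj L) N H)).integratedOperator (hu.restrict _) (hc.restrict _ (continuous_finAdelicToAdelic (↥(maximalRealSubfield L)) L (IsCMField.complexConj L) N H)) νf e) :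
    ∀ j, Commute P (T j) := fun j => by
  rw [hPdef, hT j]
  exact commute_kTypeLevel_pureTensor_of_conjInvariant π hu hc (archToAdelic (↥(maximalRealSubfield L)) L (IsCMField.complexConj L) N H) (continuous_archToAdelic (↥(maximalRealSubfield L)) L (IsCMField.complexConj L) N H)
    (finAdelicToAdelic (↥(maximalRealSubfield L)) L (IsCMField.complexConj L) N H) (continuous_finAdelicToAdelic (↥(maximalRealSubfield L)) L (IsCMField.complexConj L) N H) κ hκ μK χK νinf νf cm_hcomm (a j) (hAd j) e (b j) (heb j)

end CM

/-! ## §3 (ED. 2) The finite half of `hTP` DISCHARGED: `heb` for bi-`K′_f`-invariant test functions (★ `het_of_biinvariant`), and `hTP` letter-free for the standard Hecke operators -/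

section CMBiInvariant

variable {L : Type} [Field L] [NumberField L] [IsCMField L] {N : ℕ} {H : Matrix (Fin N) (Fin N) L}
  {K V : Type*} [Group K] [TopologicalSpace K] [MeasurableSpace K] [BorelSpace K]
  [NormedAddCommGroup V] [InnerProductSpace ℂ V] [CompleteSpace V]
  (π : ContRepresentation ℂ (cmDatum L N H).Adelic V) (hu : π.IsUnitary) (hc : π.IsStronglyContinuous)
  [MeasurableSpace (finAdelic (↥(maximalRealSubfield L)) L (IsCMField.complexConj L) N H)] [BorelSpace (finAdelic (↥(maximalRealSubfield L)) L (IsCMField.complexConj L) N H)]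
  (νf : Measure (finAdelic (↥(maximalRealSubfield L)) L (IsCMField.complexConj L) N H)) [IsFiniteMeasureOnCompacts νf] [νf.IsMulLeftInvariant] [νf.IsInvInvariant]
  (K'f : Subgroup (finAdelic (↥(maximalRealSubfield L)) L (IsCMField.complexConj L) N H)) (e : C_c(finAdelic (↥(maximalRealSubfield L)) L (IsCMField.complexConj L) N H, ℂ)) (he0 : ∀ x, x ∉ K'f → e x = 0) (he1 : ∫ x, e x ∂νf = 1)
  {J : Type*}

include he0 he1 in
/-- **ED. 2 — `heb` DISCHARGED FOR BI-`K′_f`-INVARIANT FINITE TEST FUNCTIONS**: the `heb` binder of `cm_hTP_of_conjInvariant` — `R_f(e) ∘L R_f(b j) = R_f(b j) ∘L R_f(e)` for every `j` — when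
each `b j` is bi-invariant under the level `K′_f` of the idempotent `e` (`he0 he1`; `νf` left- and inversion-invariant as in ★ D5′-cm's frame, right invariance derived by `Measure.inv_eq_self`):
★ `het_of_biinvariant` (K2E2-p12: `R(e) R(t) = R(t) = R(t) R(e)`, operator identities only — no convolution, no σ-finiteness). [cite: DeitmarEchterhoff2014, Lemma 1.6.3] [cite: BorelJacquet1979, §4.1] -/
theorem cm_heb_of_biInvariant (b : J → C_c(finAdelic (↥(maximalRealSubfield L)) L (IsCMField.complexConj L) N H, ℂ))
    (hbl : ∀ j, ∀ k ∈ K'f, ∀ x, b j (k * x) = b j x) (hbr : ∀ j, ∀ k ∈ K'f, ∀ x, b j (x * k) = b j x) :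
    ∀ j, (π.restrict (finAdelicToAdelic (↥(maximalRealSubfield L)) L (IsCMField.complexConj L) N H)).integratedOperator (hu.restrict _) (hc.restrict _ (continuous_finAdelicToAdelic (↥(maximalRealSubfield L)) L (IsCMField.complexConj L) N H)) νf e ∘L
        (π.restrict (finAdelicToAdelic (↥(maximalRealSubfield L)) L (IsCMField.complexConj L) N H)).integratedOperator (hu.restrict _) (hc.restrict _ (continuous_finAdelicToAdelic (↥(maximalRealSubfield L)) L (IsCMField.complexConj L) N H)) νf (b j) =
      (π.restrict (finAdelicToAdelic (↥(maximalRealSubfield L)) L (IsCMField.complexConj L) N H)).integratedOperator (hu.restrict _) (hc.restrict _ (continuous_finAdelicToAdelic (↥(maximalRealSubfield L)) L (IsCMField.complexConj L) N H)) νf (b j) ∘L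
        (π.restrict (finAdelicToAdelic (↥(maximalRealSubfield L)) L (IsCMField.complexConj L) N H)).integratedOperator (hu.restrict _) (hc.restrict _ (continuous_finAdelicToAdelic (↥(maximalRealSubfield L)) L (IsCMField.complexConj L) N H)) νf e := fun j => by
  haveI : νf.IsMulRightInvariant := by rw [← Measure.inv_eq_self νf]; infer_instance
  exact Summit.HodgeConjecture.HodgeConjecture.Cruxes.H413.K2E1KTypeProjectorPureTensorU.het_of_biinvariant (π.restrict (finAdelicToAdelic (↥(maximalRealSubfield L)) L (IsCMField.complexConj L) N H)) (hu.restrict _)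
    (hc.restrict _ (continuous_finAdelicToAdelic (↥(maximalRealSubfield L)) L (IsCMField.complexConj L) N H)) νf K'f e he0 he1 (b j) (hbl j) (hbr j)

variable [MeasurableSpace (UnitaryGroup.arch (↥(maximalRealSubfield L)) L (IsCMField.complexConj L) N H)] [BorelSpace (UnitaryGroup.arch (↥(maximalRealSubfield L)) L (IsCMField.complexConj L) N H)]
  (νinf : Measure (UnitaryGroup.arch (↥(maximalRealSubfield L)) L (IsCMField.complexConj L) N H)) [IsFiniteMeasureOnCompacts νinf] [νinf.IsMulLeftInvariant] [νinf.IsMulRightInvariant] [MeasurableMul (UnitaryGroup.arch (↥(maximalRealSubfield L)) L (IsCMField.complexConj L) N H)]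
  (κ : K →* UnitaryGroup.arch (↥(maximalRealSubfield L)) L (IsCMField.complexConj L) N H) (hκ : Continuous κ) (μK : Measure K) [IsFiniteMeasureOnCompacts μK] (χK : C_c(K, ℂ))

include he0 he1 in
/-- **ED. 2 — `hTP` LETTER-FREE FOR THE STANDARD HECKE OPERATORS**: with `P := π_K(χK) ∘L R_f(e)` (★ D5′-cm's `hPdef` spelling; ANY kernel `χK` — characters or `χ_τ♮`) and
`T j := R_∞(a j) ∘L R_f(b j)` where `a j` is invariant under conjugation by `κ(K)` and `b j` is bi-`K′_f`-invariant, `∀ j, Commute P (T j)` — `cm_hTP_of_conjInvariant` ∘ `cm_heb_of_biInvariant`.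
[cite: Knapp1986, VIII §3] [cite: Gelbart1975, (10.12)–(10.13)] [cite: BorelJacquet1979, §4.1] -/
theorem cm_hTP_of_conjInvariant_of_biInvariant (a : J → C_c(UnitaryGroup.arch (↥(maximalRealSubfield L)) L (IsCMField.complexConj L) N H, ℂ)) (b : J → C_c(finAdelic (↥(maximalRealSubfield L)) L (IsCMField.complexConj L) N H, ℂ)) (T : J → V →L[ℂ] V)
    (hT : ∀ j, T j = (π.restrict (archToAdelic (↥(maximalRealSubfield L)) L (IsCMField.complexConj L) N H)).integratedOperator (hu.restrict _) (hc.restrict _ (continuous_archToAdelic (↥(maximalRealSubfield L)) L (IsCMField.complexConj L) N H)) νinf (a j) ∘L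
      (π.restrict (finAdelicToAdelic (↥(maximalRealSubfield L)) L (IsCMField.complexConj L) N H)).integratedOperator (hu.restrict _) (hc.restrict _ (continuous_finAdelicToAdelic (↥(maximalRealSubfield L)) L (IsCMField.complexConj L) N H)) νf (b j))
    (hAd : ∀ (j : J) (k : K) (x : UnitaryGroup.arch (↥(maximalRealSubfield L)) L (IsCMField.complexConj L) N H), a j (κ k * x * (κ k)⁻¹) = a j x)
    (hbl : ∀ j, ∀ k ∈ K'f, ∀ x, b j (k * x) = b j x) (hbr : ∀ j, ∀ k ∈ K'f, ∀ x, b j (x * k) = b j x)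
    (P : V →L[ℂ] V) (hPdef : P = (π.restrict ((archToAdelic (↥(maximalRealSubfield L)) L (IsCMField.complexConj L) N H).comp κ)).integratedOperator (hu.restrict _)
          (hc.restrict _ ((continuous_archToAdelic (↥(maximalRealSubfield L)) L (IsCMField.complexConj L) N H).comp hκ)) μK χK ∘L
        (π.restrict (finAdelicToAdelic (↥(maximalRealSubfield L)) L (IsCMField.complexConj L) N H)).integratedOperator (hu.restrict _) (hc.restrict _ (continuous_finAdelicToAdelic (↥(maximalRealSubfield L)) L (IsCMField.complexConj L) N H)) νf e) :
    ∀ j, Commute P (T j) :=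
  cm_hTP_of_conjInvariant π hu hc νinf νf κ hκ μK χK e a b T hT hAd (cm_heb_of_biInvariant π hu hc νf K'f e he0 he1 b hbl hbr) P hPdef

end CMBiInvariant

end Summit.HodgeConjecture.HodgeConjecture.R90.S8

end
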